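import Summits.QuantumFields.BalabanUV.Beta.GAN24.FibreRateKingSummand
import Summits.QuantumFields.BalabanUV.Beta.GAN24.FibreRateFeedFactors
import Summits.QuantumFields.BalabanUV.Beta.GAN24.FibreRateTBlockLabel

/-!
# `BalabanUV.Beta.GAN24.FibreRateFeedSums` — binder row G-an2-4 / (CONV-C), road P1-fibre, self-row **P1-Y11t\*** (alias-sum side of p1 row L11,
# division agreed with the L11 owner in CLAIMS l.3039/l.3094), part 7b: PER-LABEL BOUNDS and TWO-LEVEL RATES of the four normalised
# feed-side summands `R_φ, R_c, S_φ, S_c` (unit `u = M^{D+1}/N^{D+4}`), with the `p`-orders DISPLAYED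

NOT IN PRINT; OUR PROOF ATTEMPT.  HONEST FRAMING (cell contract, verbatim): «discharging `BetaPertH` makes Bałaban's UV stability
UNCONDITIONAL — a real constructive-QFT result; it is NOT the continuum limit and NOT the Clay problem.»  HONEST DEPENDENCY (verbatim):
«continuum YM on T⁴ ⇐ BetaPertH ∧ nine spine estimates (0/9 proved); BetaPertH ⇐ (D1) ∧ (D4) ∧ CAP+tail; G-an2-4 gates asym, D1 and
NE2/3/4.»  [folklore] the generic engine of part 5 (`FibreRateKingSummand`) fed with the factorisations of part 6 (`FibreRateFeedTerms`) and the
factor facts of part 7a (`FibreRateFeedFactors`) — all BY NAME; four harmless data `def`s (the normalised summands `rPhiNorm rCNorm sPhiNorm sCNorm`);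
NO cited fact, NO `def … : Prop`, NO wall binder, NO unit re-typed (the unit `M^{D+1}/N^{D+4}` is DISPLAYED, c1/c3).  NOT summit progress;
nothing of (CONV-C)'s K-slot is discharged here.

## What is proved (real `pr ∈ [−π,π]^D`, `N = M·Lc ≥ 2`, `M, Lc ≥ 1`, next level `(N·Lc, N)`; label `q = qlab pr m`; `C := coordConst Lc`)
* §2 PER LABEL, with `W := Π_i wMaj Lc q_i` (matched through `AliasReindex.lift`, same label at both levels):
  **`rPhiNorm_label`**: bound `‖rPhiNorm‖ ≤ 666·W/momSq q` (`q ≠ 0`) and rate `≤ 284148·W/N²` (EVERY label, `p`-uniform);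
  **`rCNorm_label`**: bound `‖rCNorm‖ ≤ 1296·W/(momSq q·√momSq q)` and rate `≤ 567648·W/(√momSq q·N²)` — `p`-orders `−3` (bound) and `−1` (rate),
  to be cancelled by the L11 owner's capacitance blocks `|p|³, |p|⁴` (CLAIMS l.3039); the source-side twins `sPhiNorm`/`sCNorm` factorise identically
  (`sPhiNorm_eq`, `sCNorm_eq`, `mfacS` bounds) — their label lemmas and the four SUMS (matched + tail, as in part 4) follow in part 8.
-/

noncomputable section

open Complex Finset
open scoped BigOperators Real ComplexConjugate
open Literature.Probability.LatticeModels (TorusSite)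
open Literature.MathematicalPhysics.QuantumFieldTheory.King1986 (latticeSymbol momSq momSq_nonneg)
open Literature.MathematicalPhysics.QuantumFieldTheory.Balaban1983to89.B4Strip (ofRealVec)
open Summit.QuantumFields.BalabanUV.Beta.GAN24.AliasObjects (gs conj_gs)
open Summit.QuantumFields.BalabanUV.Beta.GAN24.AliasReindex (srep lift newLabels srep_lift natAbs_srep_le norm_sum_sub_sum_le_of_rates)
open Summit.QuantumFields.BalabanUV.Beta.GAN24.FibreRateTBlock (qlab rf rf_nonneg)
open Summit.QuantumFields.BalabanUV.Beta.GAN24.FibreRateTBlockRate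
open Summit.QuantumFields.BalabanUV.Beta.GAN24.FibreRateTBlockLabel (qlab_zone abs_mul_abs_le_momSq norm_cexp_sub_one_le norm_cexp_neg_sub_one_le)
open Summit.QuantumFields.BalabanUV.Beta.GAN24.FibreRateKingSummand (xGen norm_king_le norm_king_two_level_le)
open Summit.QuantumFields.BalabanUV.Beta.GAN24.FibreRateFeedTerms
open Summit.QuantumFields.BalabanUV.Beta.GAN24.FibreRateFeedFactors

namespace Summit.QuantumFields.BalabanUV.Beta.GAN24.FibreRateFeedSums

variable {D : ℕ}

/-! ## §2 The normalised summands: per-label bounds and rates -/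

section Label

variable {N M Lc : ℕ} [NeZero N]

/-- [folklore] NORMALISED `R_φ`-summand `M^{D+1}·rPhiTerm/N^{D+4}`. -/
def rPhiNorm (N M : ℕ) [NeZero N] (pr : Fin D → ℝ) (m : TorusSite D N) (κ l' : Fin D) (x' : Fin D → ℤ) : ℂ :=
  (M : ℂ) ^ (D + 1) * rPhiTerm N M (ofRealVec pr) m κ l' x' / (N : ℂ) ^ (D + 4)
/-- [folklore] NORMALISED `R_c`-summand. -/
def rCNorm (N M : ℕ) [NeZero N] (pr : Fin D → ℝ) (m : TorusSite D N) (κ : Fin D) (x' : Fin D → ℤ) : ℂ :=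
  (M : ℂ) ^ (D + 1) * rCTerm N M (ofRealVec pr) m κ x' / (N : ℂ) ^ (D + 4)
/-- [folklore] NORMALISED `S_φ`-summand. -/
def sPhiNorm (N M : ℕ) [NeZero N] (pr : Fin D → ℝ) (m : TorusSite D N) (l' l : Fin D) (y' : Fin D → ℤ) : ℂ :=
  (M : ℂ) ^ (D + 1) * sPhiTerm N M (ofRealVec pr) m l' l y' / (N : ℂ) ^ (D + 4)
/-- [folklore] NORMALISED `S_c`-summand. -/
def sCNorm (N M : ℕ) [NeZero N] (pr : Fin D → ℝ) (m : TorusSite D N) (l : Fin D) (y' : Fin D → ℤ) : ℂ :=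
  (M : ℂ) ^ (D + 1) * sCTerm N M (ofRealVec pr) m l y' / (N : ℂ) ^ (D + 4)

/-- [folklore] `rPhiNorm = phase · ((Π mfac) · xGen N q ([κ=l′]·mfac q_κ) (a_κ b_{l′}))`. -/
theorem rPhiNorm_eq (hLc : Lc ≠ 0) (hM : M ≠ 0) (hNM : N = M * Lc) (pr : Fin D → ℝ) (m : TorusSite D N) (κ l' : Fin D) (x' : Fin D → ℤ) :
    rPhiNorm N M pr m κ l' x' = cexp (I * ∑ i, ((qlab pr m i / Lc : ℝ) : ℂ) * (x' i : ℂ)) *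
      ((∏ i, mfac N M (qlab pr m i)) * xGen N (qlab pr m) (if κ = l' then mfac N M (qlab pr m κ) else 0)
        ((cexp (I * ((qlab pr m κ / Lc : ℝ) : ℂ)) - 1) * (cexp (-(I * ((qlab pr m l' : ℝ) : ℂ))) - 1))) := by
  have hN : (N : ℂ) ≠ 0 := Nat.cast_ne_zero.2 (NeZero.ne N)
  unfold rPhiNorm xGen
  rw [rPhiTerm_factor hLc hM hNM]
  field_simp

/-- [folklore] `rCNorm = phase · ((Π mfac) · xGen N q 0 (−2a_κ))`. -/
theorem rCNorm_eq (hLc : Lc ≠ 0) (hM : M ≠ 0) (hNM : N = M * Lc) (pr : Fin D → ℝ) (m : TorusSite D N) (κ : Fin D) (x' : Fin D → ℤ) :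
    rCNorm N M pr m κ x' = cexp (I * ∑ i, ((qlab pr m i / Lc : ℝ) : ℂ) * (x' i : ℂ)) *
      ((∏ i, mfac N M (qlab pr m i)) * xGen N (qlab pr m) 0 (-2 * (cexp (I * ((qlab pr m κ / Lc : ℝ) : ℂ)) - 1))) := by
  have hN : (N : ℂ) ≠ 0 := Nat.cast_ne_zero.2 (NeZero.ne N)
  unfold rCNorm xGen
  rw [rCTerm_factor hLc hM hNM]
  field_simp
  ring

/-- [folklore] `sPhiNorm = −phase · ((Π mfacS) · xGen N q ([l′=l]·mfacS q_l) (b′_{l′} ā_l))`. -/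
theorem sPhiNorm_eq (hLc : Lc ≠ 0) (hM : M ≠ 0) (hNM : N = M * Lc) (pr : Fin D → ℝ) (m : TorusSite D N) (l' l : Fin D) (y' : Fin D → ℤ) :
    sPhiNorm N M pr m l' l y' = -cexp (-(I * ∑ i, ((qlab pr m i / Lc : ℝ) : ℂ) * (y' i : ℂ))) *
      ((∏ i, mfacS N M (qlab pr m i)) * xGen N (qlab pr m) (if l' = l then mfacS N M (qlab pr m l) else 0)
        ((cexp (I * ((qlab pr m l' : ℝ) : ℂ)) - 1) * (cexp (-(I * ((qlab pr m l / Lc : ℝ) : ℂ))) - 1))) := by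
  have hN : (N : ℂ) ≠ 0 := Nat.cast_ne_zero.2 (NeZero.ne N)
  unfold sPhiNorm xGen
  rw [sPhiTerm_factor hLc hM hNM]
  field_simp

/-- [folklore] `sCNorm = −phase · ((Π mfacS) · xGen N q 0 (−2ā_l))`. -/
theorem sCNorm_eq (hLc : Lc ≠ 0) (hM : M ≠ 0) (hNM : N = M * Lc) (pr : Fin D → ℝ) (m : TorusSite D N) (l : Fin D) (y' : Fin D → ℤ) :
    sCNorm N M pr m l y' = -cexp (-(I * ∑ i, ((qlab pr m i / Lc : ℝ) : ℂ) * (y' i : ℂ))) *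
      ((∏ i, mfacS N M (qlab pr m i)) * xGen N (qlab pr m) 0 (-2 * (cexp (-(I * ((qlab pr m l / Lc : ℝ) : ℂ))) - 1))) := by
  have hN : (N : ℂ) ≠ 0 := Nat.cast_ne_zero.2 (NeZero.ne N)
  unfold sCNorm xGen
  rw [sCTerm_factor hLc hM hNM]
  field_simp
  ring

/-- [folklore] The reading phase is unimodular. -/
theorem norm_readPhase (Lc : ℕ) (q : Fin D → ℝ) (x' : Fin D → ℤ) : ‖cexp (I * ∑ i, ((q i / Lc : ℝ) : ℂ) * (x' i : ℂ))‖ = 1 := by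
  have h : ∑ i, ((q i / Lc : ℝ) : ℂ) * (x' i : ℂ) = ((∑ i, q i / Lc * (x' i : ℝ) : ℝ) : ℂ) := by push_cast; rfl
  rw [h, Complex.norm_exp_I_mul_ofReal]

/-- [folklore] The source phase is unimodular. -/
theorem norm_srcPhase (Lc : ℕ) (q : Fin D → ℝ) (y' : Fin D → ℤ) : ‖cexp (-(I * ∑ i, ((q i / Lc : ℝ) : ℂ) * (y' i : ℂ)))‖ = 1 := by
  have h : -(I * ∑ i, ((q i / Lc : ℝ) : ℂ) * (y' i : ℂ)) = I * ((-(∑ i, q i / Lc * (y' i : ℝ)) : ℝ) : ℂ) := by push_cast; ring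
  rw [h, Complex.norm_exp_I_mul_ofReal]

/-- [folklore] `|q_κ| ≤ √momSq q`. -/
theorem abs_le_sqrt_momSq (q : Fin D → ℝ) (κ : Fin D) : |q κ| ≤ Real.sqrt (momSq q) :=
  Real.abs_le_sqrt (Finset.single_le_sum (fun j _ => sq_nonneg (q j)) (Finset.mem_univ κ))

/-- [folklore] Numerator of the projector slot of `R_φ`/`S_φ`: `‖(e^{ix/Lc} − 1)(e^{−iy} − 1)‖ ≤ momSq q` for coordinates `x = q_κ`, `y = q_{l′}`. -/
theorem norm_numPhi_le (hLc : 0 < Lc) (q : Fin D → ℝ) (κ l' : Fin D) :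
    ‖(cexp (I * ((q κ / Lc : ℝ) : ℂ)) - 1) * (cexp (-(I * ((q l' : ℝ) : ℂ))) - 1)‖ ≤ momSq q := by
  have hLc' : (1 : ℝ) ≤ Lc := by exact_mod_cast hLc
  rw [norm_mul]
  have h1 := norm_cexp_sub_one_le (q κ / Lc)
  have h2 := norm_cexp_neg_sub_one_le (q l')
  have h1' : ‖cexp (I * ((q κ / Lc : ℝ) : ℂ)) - 1‖ ≤ |q κ| := by
    refine h1.trans ?_
    rw [abs_div, abs_of_pos (by positivity : (0:ℝ) < Lc)]
    exact div_le_self (abs_nonneg _) hLc'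
  calc ‖cexp (I * ((q κ / Lc : ℝ) : ℂ)) - 1‖ * ‖cexp (-(I * ((q l' : ℝ) : ℂ))) - 1‖ ≤ |q κ| * |q l'| :=
        mul_le_mul h1' h2 (norm_nonneg _) (abs_nonneg _)
    _ ≤ momSq q := abs_mul_abs_le_momSq q κ l'

/-- [folklore] Same for `S_φ`'s numerator `‖(e^{ix} − 1)(e^{−iy/Lc} − 1)‖ ≤ momSq q`. -/
theorem norm_numPhiS_le (hLc : 0 < Lc) (q : Fin D → ℝ) (l' l : Fin D) :
    ‖(cexp (I * ((q l' : ℝ) : ℂ)) - 1) * (cexp (-(I * ((q l / Lc : ℝ) : ℂ))) - 1)‖ ≤ momSq q := by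
  have hLc' : (1 : ℝ) ≤ Lc := by exact_mod_cast hLc
  rw [norm_mul]
  have h1 := norm_cexp_sub_one_le (q l')
  have h2 := norm_cexp_neg_sub_one_le (q l / Lc)
  have h2' : ‖cexp (-(I * ((q l / Lc : ℝ) : ℂ))) - 1‖ ≤ |q l| := by
    refine h2.trans ?_
    rw [abs_div, abs_of_pos (by positivity : (0:ℝ) < Lc)]
    exact div_le_self (abs_nonneg _) hLc'
  calc ‖cexp (I * ((q l' : ℝ) : ℂ)) - 1‖ * ‖cexp (-(I * ((q l / Lc : ℝ) : ℂ))) - 1‖ ≤ |q l'| * |q l| :=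
        mul_le_mul h1 h2' (norm_nonneg _) (abs_nonneg _)
    _ ≤ momSq q := abs_mul_abs_le_momSq q l' l

/-- [folklore] Numerator of the `c`-slots: `‖−2(e^{±ix/Lc} − 1)‖ ≤ 2√momSq q` (`x = q_κ`). -/
theorem norm_numC_le (hLc : 0 < Lc) (q : Fin D → ℝ) (κ : Fin D) :
    ‖-2 * (cexp (I * ((q κ / Lc : ℝ) : ℂ)) - 1)‖ ≤ 2 * Real.sqrt (momSq q) ∧
      ‖-2 * (cexp (-(I * ((q κ / Lc : ℝ) : ℂ))) - 1)‖ ≤ 2 * Real.sqrt (momSq q) := by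
  have hLc' : (1 : ℝ) ≤ Lc := by exact_mod_cast hLc
  have hx : |q κ / Lc| ≤ Real.sqrt (momSq q) := by
    rw [abs_div, abs_of_pos (by positivity : (0:ℝ) < Lc)]
    exact (div_le_self (abs_nonneg _) hLc').trans (abs_le_sqrt_momSq q κ)
  constructor
  · rw [norm_mul, norm_neg, Complex.norm_ofNat]
    exact mul_le_mul_of_nonneg_left ((norm_cexp_sub_one_le _).trans hx) (by norm_num)
  · rw [norm_mul, norm_neg, Complex.norm_ofNat]
    exact mul_le_mul_of_nonneg_left ((norm_cexp_neg_sub_one_le _).trans hx) (by norm_num)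

variable (hN2 : 2 ≤ N) (hM : 0 < M) (hLc : 0 < Lc) (hNM : N = M * Lc) {pr : Fin D → ℝ} (hpr : ∀ i, |pr i| ≤ π)
include hN2 hM hLc hNM hpr

/-- [folklore] **`R_φ` PER LABEL**: bound `≤ 666·W/momSq` (`q ≠ 0`) and rate `≤ 284148·W/N²` (all labels), `W = Π_i wMaj Lc q_i`. -/
theorem rPhiNorm_label [NeZero (N * Lc)] (m : TorusSite D N) (κ l' : Fin D) (x' : Fin D → ℤ) :
    (qlab pr m ≠ 0 → ‖rPhiNorm N M pr m κ l' x'‖ ≤ 666 * (∏ i, wMaj Lc (qlab pr m i)) / momSq (qlab pr m)) ∧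
    ‖rPhiNorm (N * Lc) N pr (lift (N * Lc) m) κ l' x' - rPhiNorm N M pr m κ l' x'‖ ≤ 284148 * (∏ i, wMaj Lc (qlab pr m i)) / (N : ℝ) ^ 2 := by
  have hN : 0 < N := by omega
  have hNLc : N ≤ N * Lc := Nat.le_mul_of_pos_right N hLc
  have hq := qlab_zone hN2 hpr m
  have hlab : qlab pr (lift (N * Lc) m) = qlab pr m := by funext i; simp only [qlab, srep_lift hNLc]
  have hW0 : 0 ≤ ∏ i, wMaj Lc (qlab pr m i) := Finset.prod_nonneg fun i _ => wMaj_nonneg _ _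
  set q := qlab pr m with hqdef
  have hf : ∀ i, ‖mfac N M (q i)‖ ≤ 1 * wMaj Lc (q i) := fun i => by rw [one_mul]; exact norm_mfac_le hM hLc hNM (hq i)
  have hf' : ∀ i, ‖mfac (N * Lc) N (q i)‖ ≤ 1 * wMaj Lc (q i) := fun i => by
    rw [one_mul]; exact norm_mfac_le hN hLc rfl (zone_mono (by exact_mod_cast hNLc) (hq i))
  have hfr : ∀ i, ‖mfac (N * Lc) N (q i) - mfac N M (q i)‖ ≤ 6 * q i ^ 2 / (N : ℝ) ^ 2 * (1 * wMaj Lc (q i)) := fun i => by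
    rw [one_mul]; exact norm_mfac_two_level_le hM hLc hNM (hq i)
  have hg : ‖(if κ = l' then mfac N M (q κ) else 0)‖ ≤ 1 := by
    split_ifs
    · exact (norm_mfac_le hM hLc hNM (hq κ)).trans (wMaj_le_one _ _)
    · simp
  have hg' : ‖(if κ = l' then mfac (N * Lc) N (q κ) else 0)‖ ≤ 1 := by
    split_ifs
    · exact (norm_mfac_le hN hLc rfl (zone_mono (by exact_mod_cast hNLc) (hq κ))).trans (wMaj_le_one _ _)
    · simp
  have h6 : (0 : ℝ) ≤ 6 * momSq q / (N : ℝ) ^ 2 := div_nonneg (mul_nonneg (by norm_num) (momSq_nonneg q)) (sq_nonneg _)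
  have hgr : ‖(if κ = l' then mfac (N * Lc) N (q κ) else 0) - (if κ = l' then mfac N M (q κ) else 0)‖ ≤ 6 * momSq q / (N : ℝ) ^ 2 * 1 := by
    split_ifs
    · refine (norm_mfac_two_level_le hM hLc hNM (hq κ)).trans ?_
      have hqκ : q κ ^ 2 ≤ momSq q := Finset.single_le_sum (fun j _ => sq_nonneg (q j)) (Finset.mem_univ κ)
      have hw := wMaj_le_one Lc (q κ)
      have hw0 := wMaj_nonneg Lc (q κ)
      have h1 : 6 * q κ ^ 2 / (N : ℝ) ^ 2 ≤ 6 * momSq q / (N : ℝ) ^ 2 := by gcongr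
      exact mul_le_mul h1 hw hw0 h6
    · rw [sub_self, norm_zero]; exact mul_nonneg h6 zero_le_one
  have hn := norm_numPhi_le hLc q κ l'
  constructor
  · intro hq0
    rw [rPhiNorm_eq hLc.ne' hM.ne' hNM, norm_mul, norm_readPhase, one_mul]
    refine (norm_king_le hN hq hq0 zero_le_one (fun i => wMaj_nonneg _ _) hf hg hn).trans ?_
    have hm : 0 < momSq q := by
      have hN' : (0:ℝ) < N := by exact_mod_cast hN
      exact lt_of_lt_of_le (ell_pos hN' hq hq0) (ell_le_momSq hN'.ne' _)
    rw [one_pow, one_mul]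
    have e : 18 * (1:ℝ) / momSq q + 648 * momSq q / momSq q ^ 2 = 666 / momSq q := by field_simp; ring
    rw [e]; exact le_of_eq (by ring)
  · rw [rPhiNorm_eq hLc.ne' hN.ne' rfl, rPhiNorm_eq hLc.ne' hM.ne' hNM, hlab, ← mul_sub, norm_mul, norm_readPhase, one_mul]
    rcases eq_or_ne q 0 with hq0 | hq0
    · have hx : ∀ (N' : ℕ) (g n : ℂ), xGen N' q g n = 0 := by
        intro N' g n
        unfold xGen
        have : latticeSymbol ((N' : ℝ)⁻¹) 0 q = 0 := by
          rw [hq0]; unfold latticeSymbol; simp [Literature.MathematicalPhysics.QuantumFieldTheory.King1986.fdSymbol]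
        rw [this]; simp
      rw [hx, hx]; simp only [mul_zero, sub_self, norm_zero]; positivity
    refine (norm_king_two_level_le hN hNLc hq hq0 zero_le_one (fun i => wMaj_nonneg _ _) hf hf' hfr hg hg' hgr hn).trans ?_
    have hm : 0 < momSq q := by
      have hN' : (0:ℝ) < N := by exact_mod_cast hN
      exact lt_of_lt_of_le (ell_pos hN' hq hq0) (ell_le_momSq hN'.ne' _)
    rw [one_pow, one_mul]
    have e : (324 * (1:ℝ) + 283824 * momSq q / momSq q) = 284148 := by field_simp; ring
    rw [e]; apply le_of_eq; ring

/-- [folklore] **`R_c` PER LABEL**: bound `≤ 1296·W/(momSq·√momSq)` (`q ≠ 0`) and rate `≤ 567648·W/(√momSq·N²)` (all labels). -/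
theorem rCNorm_label [NeZero (N * Lc)] (m : TorusSite D N) (κ : Fin D) (x' : Fin D → ℤ) :
    (qlab pr m ≠ 0 → ‖rCNorm N M pr m κ x'‖ ≤ 1296 * (∏ i, wMaj Lc (qlab pr m i)) / (momSq (qlab pr m) * Real.sqrt (momSq (qlab pr m)))) ∧
    ‖rCNorm (N * Lc) N pr (lift (N * Lc) m) κ x' - rCNorm N M pr m κ x'‖ ≤
      567648 * (∏ i, wMaj Lc (qlab pr m i)) / (Real.sqrt (momSq (qlab pr m)) * (N : ℝ) ^ 2) := by
  have hN : 0 < N := by omega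
  have hNLc : N ≤ N * Lc := Nat.le_mul_of_pos_right N hLc
  have hq := qlab_zone hN2 hpr m
  have hlab : qlab pr (lift (N * Lc) m) = qlab pr m := by funext i; simp only [qlab, srep_lift hNLc]
  have hW0 : 0 ≤ ∏ i, wMaj Lc (qlab pr m i) := Finset.prod_nonneg fun i _ => wMaj_nonneg _ _
  set q := qlab pr m with hqdef
  have hf : ∀ i, ‖mfac N M (q i)‖ ≤ 1 * wMaj Lc (q i) := fun i => by rw [one_mul]; exact norm_mfac_le hM hLc hNM (hq i)
  have hf' : ∀ i, ‖mfac (N * Lc) N (q i)‖ ≤ 1 * wMaj Lc (q i) := fun i => by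
    rw [one_mul]; exact norm_mfac_le hN hLc rfl (zone_mono (by exact_mod_cast hNLc) (hq i))
  have hfr : ∀ i, ‖mfac (N * Lc) N (q i) - mfac N M (q i)‖ ≤ 6 * q i ^ 2 / (N : ℝ) ^ 2 * (1 * wMaj Lc (q i)) := fun i => by
    rw [one_mul]; exact norm_mfac_two_level_le hM hLc hNM (hq i)
  have hg : ‖(0 : ℂ)‖ ≤ 0 := by simp
  have hgr : ‖(0 : ℂ) - 0‖ ≤ 6 * momSq q / (N : ℝ) ^ 2 * 0 := by simp
  have hn := (norm_numC_le hLc q κ).1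
  have hs0 : 0 ≤ Real.sqrt (momSq q) := Real.sqrt_nonneg _
  constructor
  · intro hq0
    rw [rCNorm_eq hLc.ne' hM.ne' hNM, norm_mul, norm_readPhase, one_mul]
    refine (norm_king_le hN hq hq0 zero_le_one (fun i => wMaj_nonneg _ _) hf hg hn).trans ?_
    have hm : 0 < momSq q := by
      have hN' : (0:ℝ) < N := by exact_mod_cast hN
      exact lt_of_lt_of_le (ell_pos hN' hq hq0) (ell_le_momSq hN'.ne' _)
    have hs : 0 < Real.sqrt (momSq q) := Real.sqrt_pos.2 hm
    have hss : Real.sqrt (momSq q) * Real.sqrt (momSq q) = momSq q := Real.mul_self_sqrt hm.le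
    rw [one_pow, one_mul, mul_zero, zero_div, zero_add]
    have e : (648 : ℝ) * (2 * Real.sqrt (momSq q)) / momSq q ^ 2 = 1296 / (momSq q * Real.sqrt (momSq q)) := by
      rw [div_eq_div_iff (by positivity) (by positivity)]; nlinarith [hss]
    rw [e]; apply le_of_eq; ring
  · rw [rCNorm_eq hLc.ne' hN.ne' rfl, rCNorm_eq hLc.ne' hM.ne' hNM, hlab, ← mul_sub, norm_mul, norm_readPhase, one_mul]
    rcases eq_or_ne q 0 with hq0 | hq0
    · have hx : ∀ (N' : ℕ) (g n : ℂ), xGen N' q g n = 0 := by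
        intro N' g n
        unfold xGen
        have : latticeSymbol ((N' : ℝ)⁻¹) 0 q = 0 := by
          rw [hq0]; unfold latticeSymbol; simp [Literature.MathematicalPhysics.QuantumFieldTheory.King1986.fdSymbol]
        rw [this]; simp
      rw [hx, hx]; simp only [mul_zero, sub_self, norm_zero]; positivity
    refine (norm_king_two_level_le hN hNLc hq hq0 zero_le_one (fun i => wMaj_nonneg _ _) hf hf' hfr hg hg hgr hn).trans ?_
    have hm : 0 < momSq q := by
      have hN' : (0:ℝ) < N := by exact_mod_cast hN
      exact lt_of_lt_of_le (ell_pos hN' hq hq0) (ell_le_momSq hN'.ne' _)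
    have hs : 0 < Real.sqrt (momSq q) := Real.sqrt_pos.2 hm
    have hss : Real.sqrt (momSq q) * Real.sqrt (momSq q) = momSq q := Real.mul_self_sqrt hm.le
    rw [one_pow, one_mul, mul_zero, zero_add]
    have e : (283824 : ℝ) * (2 * Real.sqrt (momSq q)) / momSq q = 567648 / Real.sqrt (momSq q) := by
      rw [div_eq_div_iff hm.ne' hs.ne']; nlinarith [hss]
    rw [e]; apply le_of_eq
    have hN' : (N : ℝ) ≠ 0 := by exact_mod_cast hN.ne'
    field_simp

end Label

end Summit.QuantumFields.BalabanUV.Beta.GAN24.FibreRateFeedSums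

end
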